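import Summits.QuantumFields.BalabanUV.Beta.GAN24.TaylorLamLegEL
import Literature.MathematicalPhysics.QuantumFieldTheory.Balaban1983to89.Beta.ResolventComposition

/-!
# `BalabanUV.Beta.GAN24.TaylorLamVertexPairing` — binder row G-an2-4 / (CONV-C), S-slot, road «S3-Taylor», Λ rows (S3-Lt / S3-L / S3-L0):
# THE VERTEX PAIRING OF THE MULTIPLIER-RESPONSE LEG IS `−𝒬ᵀ_R` OF THE TOP-LEVEL Φ̃-LEG (exact identity, every `d`, every depth `R`)

NOT IN PRINT; OUR PROOF ATTEMPT.  HONEST FRAMING (cell contract, verbatim): «discharging `BetaPertH` makes Bałaban's UV stability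
UNCONDITIONAL — a real constructive-QFT result; it is NOT the continuum limit and NOT the Clay problem.»  HONEST DEPENDENCY (verbatim):
«continuum YM on T⁴ ⇐ BetaPertH ∧ nine spine estimates (0/9 proved); BetaPertH ⇐ (D1) ∧ (D4) ∧ CAP+tail; G-an2-4 gates asym, D1 and
NE2/3/4.»  [folklore] lattice algebra over an2's / an5's DEFINITIONS and LANDED identities; no estimate beyond a triangle inequality, no cited
fact, no `def`, no `Prop` mirror.  One input of the Λ SHAPE rows of `GAN24/StencilSlotE3OfPieces.e3Shape_of_pieces`; discharges NOTHING of
«E3Shape»/«E3SupRate», (hS, hSall), the K-slot, BetaPertH by itself; NOT continuum, NOT Clay.  Unit `b2b-balaban-gan24-formalise-leaf-18`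
(gen 12), G-an2-4 formalisation swarm, 2026-08-20.

## What is proved (generic `d`; top blocking `N = N′·R`, inner level `N′`, depth `R` = number of pushes `Lc^k` in the row's use)

In the Λ templates `E3UnitSplitLevels.e3Lam_unit_split` / `e3LamTop_unit_split` / `e3Lam0_unit_split` the level-`N′` Lagrange increment
`lagrInc d Lc M N′ κ″ u = −Σ_μ Σ'_Y lamCoeffOf (KInv N′) N′ μ Y κ″ u · avgLift M (hessFF Lc μ Y)` is contracted, in its stencil index
`(κ″, u)`, against the TOP-level minimiser column `wH_N κ″ κ′ (u − N•u′)` (the chain-rule vertex).  This file evaluates that contraction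
EXACTLY:

* §1 `contourSumAdj_mul` — the adjoint semigroup law `𝒬ᵀ_{N′R} = 𝒬ᵀ_{N′} ∘ 𝒬ᵀ_R` (companion of an5's `ResolventComposition.contourSum_mul`),
  with `quo_quo` (`⌊⌊z/N′⌋/R⌋ = ⌊z/(N′R)⌋`) and `abs_curvAdj_le`.
* §2 **`vertexPair_eq`**:
  `Σ_{κ″} Σ'_u wH_N κ″ κ′ (u − N•u′) · lamCoeffOf (KInv N′) N′ μ Y κ″ u = −contourSumAdj R (fun κ y ↦ wΦ_N κ κ′ (y − u′)) μ Y`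
  for `N = N′·R` — i.e. `−Σ_{s<R} wΦ_N μ κ′ (quo R (Y − s•e_μ) − u′)`: the vertex column is CONSUMED by its own Euler–Lagrange identity
  WITHOUT gauge term (an5's `ResolventComposition.wH_EL'`, which rests on `wM_eq_zero`: the gauge multiplier of the minimiser vanishes
  identically), the two `d*d`-pairings are exchanged by an2's Green identity (`KKTFluctuationEnergy.lip1_curvAdj`, `lip2_comm`), `𝒬ᵀ_N`
  is moved onto the level-`N′` column (`lip1_contourSumAdj`), split as `𝒬ᵀ_{N′} 𝒬ᵀ_R` (§1), and the (Q)-row of that column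
  (`KernelSpecInstance.wH_Q`: `𝒬_{N′} ℋ_{N′} = δ`) collapses the sum.  What is left is the TOP-level multiplier–multiplier leg `wΦ_N`
  (the K-slot currency of `GAN24/StencilSlotE3PhiLeg`, size `N^{−2(d+1)}`) read at `R` coarse arguments — NOT the level-`N′` leg
  `wΦ_{N′}` and NOT an absolute `lamCoeffOf` bound: this is where the `(N′/N)^{d−1}` of the Λ rows' power count sits.
* §3 `vertexPair_top` (`R = 1`: `= −wΦ_N μ κ′ (Y − u′)`, row S3-Lt) and the absolute-value consequence **`abs_vertexPair_le`**:
  under a displayed decay hypothesis `|wΦ_N μ κ′ y| ≤ CΦ·e^{−δ‖y‖₁}` the pairing is `≤ R·CΦ·e^{δ}·e^{−δ‖quo R Y − u′‖₁}` (`quo_sub_smul_near`: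
  the `R` read-out points lie within sup-distance `1` of `quo R Y`).

All declarations `[folklore]`; axioms standard.  Inputs BY NAME: `TaylorLamLegEL.lamCoeffOf_KInv_eq_neg_opEL` (leaf-10),
`ResolventComposition.wH_EL'`/`contourSum_mul` (an5), `KernelSpecInstance.wH_Q`/`decay_wH`/`opEL_shift`/`contourSum_shift`/`contourSumAdj_shift`,
`KKTFluctuationEnergy.lip1_curvAdj`/`lip2_comm`/`lip1_contourSumAdj` (an2), `StepDriftWitness.sum_range_digit`.
-/

noncomputable section

open Finset
open scoped BigOperators
open Literature.MathematicalPhysics.QuantumFieldTheory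
open Literature.MathematicalPhysics.QuantumFieldTheory.Balaban1983to89
open Literature.MathematicalPhysics.QuantumFieldTheory.Balaban1983to89.Beta
open AffineAveraging (Site Form0 Form1 Form2 unitVec unitVec_apply dz curv curvAdj codiff₁ box toSite contourSum)
open AffineReproduction (contourSumAdj)
open LatticeForm (quo)
open BlochFibreUniqueness (quo_add_zsmul)
open B12Sec2to5 (l1 Decay510)
open OneStepResolventKernel (Fib KInv)
open KernelSpecInstance (wH wΦ wH_Q decay_wH opEL_shift contourSum_shift contourSumAdj_shift)
open KKTFluctuationEnergy (lip1 lip2 lip2_comm lip1_curvAdj lip1_contourSumAdj summable_shift_sub summable_curv abs_curv_le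
  summable_mul_of_bdd' contourSumAdj_eq)
open KKTFluctuationUnique (abs_le_of_decay510)
open DecimatedMomentLimit (summable_of_decay510)
open ResolventComposition (wH_EL' contourSum_mul)
open StepDriftWitness (sum_range_digit)
open BalabanStepJets (lamCoeffOf)
open Summit.QuantumFields.BalabanUV.Beta.GAN24.TaylorLamLegEL (lamCoeffOf_KInv_eq_neg_opEL abs_contourSumAdj_le)

namespace Summit.QuantumFields.BalabanUV.Beta.GAN24.TaylorLamVertexPairing

variable {d : ℕ}

/-! ## §1 The adjoint semigroup law of the straight-contour block sums, and two small bounds -/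

/-- [folklore] Nested block indices: `⌊⌊z/N′⌋/R⌋ = ⌊z/(N′R)⌋` coordinatewise. -/
theorem quo_quo {D : ℕ} (N' R : ℕ) (z : Site D) : quo R (quo N' z) = quo (N' * R) z := by
  funext j
  simp only [quo, Nat.cast_mul]
  exact Int.ediv_ediv_of_nonneg (Int.natCast_nonneg N')

/-- [folklore] **`𝒬ᵀ_{N′R} = 𝒬ᵀ_{N′} ∘ 𝒬ᵀ_R`** — the adjoint of an5's `ResolventComposition.contourSum_mul`. -/
theorem contourSumAdj_mul {D : ℕ} (N' R : ℕ) [NeZero N'] (φ : Form1 D ℝ) :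
    contourSumAdj (N' * R) φ = contourSumAdj N' (contourSumAdj R φ) := by
  funext κ x
  rw [contourSumAdj_eq, contourSumAdj_eq]
  simp_rw [contourSumAdj_eq (N := R)]
  rw [Finset.sum_comm, ← sum_range_digit N' R (Nat.pos_of_ne_zero (NeZero.ne N'))
    (fun S => φ κ (quo (N' * R) (x - (S : ℤ) • unitVec κ)))]
  refine Finset.sum_congr rfl fun s' _ => Finset.sum_congr rfl fun s _ => ?_
  rw [← quo_quo]
  congr 1
  have e : x - ((N' * s' + s : ℕ) : ℤ) • unitVec κ = x - (s : ℤ) • unitVec κ + (N' : ℤ) • (-((s' : ℤ) • unitVec κ)) := by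
    funext i
    simp only [Pi.sub_apply, Pi.add_apply, Pi.smul_apply, Pi.neg_apply, smul_eq_mul]
    push_cast
    ring
  rw [e, quo_add_zsmul]
  abel

/-- [folklore] Sup bound for the formal adjoint of the curvature: `|curvAdj F| ≤ 4(D)·M` when `|F| ≤ M`. -/
theorem abs_curvAdj_le {D : ℕ} {F : Form2 D ℝ} {M : ℝ} (hF : ∀ κ l x, |F κ l x| ≤ M) (μ : Fin D) (y : Site D) :
    |curvAdj F μ y| ≤ (D : ℝ) * (2 * M) + (D : ℝ) * (2 * M) := by
  unfold AffineAveraging.curvAdj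
  refine (abs_add_le _ _).trans (add_le_add ?_ ?_)
  · refine (Finset.abs_sum_le_sum_abs _ _).trans ?_
    calc ∑ l, |F μ l y - F μ l (y - unitVec l)| ≤ ∑ _l : Fin D, 2 * M :=
          Finset.sum_le_sum fun l _ => (abs_sub _ _).trans (by linarith [hF μ l y, hF μ l (y - unitVec l)])
      _ = (D : ℝ) * (2 * M) := by simp
  · refine (Finset.abs_sum_le_sum_abs _ _).trans ?_
    calc ∑ κ, |F κ μ (y - unitVec κ) - F κ μ y| ≤ ∑ _κ : Fin D, 2 * M :=
          Finset.sum_le_sum fun κ _ => (abs_sub _ _).trans (by linarith [hF κ μ (y - unitVec κ), hF κ μ y])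
      _ = (D : ℝ) * (2 * M) := by simp

/-! ## §2 The exact vertex pairing -/

section Pairing

variable {N N' R : ℕ} [NeZero N] [NeZero N']

/-- [folklore] **THE VERTEX PAIRING OF THE MULTIPLIER-RESPONSE LEG** (top blocking `N = N′·R`, inner level `N′`):
`Σ_{κ″} Σ'_u wH_N κ″ κ′ (u − N•u′) · lamCoeffOf (KInv N′) N′ μ Y κ″ u = −(𝒬ᵀ_R Φ̃^{(κ′,u′)}_N)_μ(Y)` with `Φ̃^{(κ′,u′)}_N κ y = wΦ_N κ κ′ (y − u′)`.
The chain: `lamCoeffOf = −d*d` of the level-`N′` column (leaf-10) → Green's identity twice (an2) → `d*d` of the TOP column `= 𝒬ᵀ_N wΦ_N`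
(an5's `wH_EL'`, gauge multiplier ≡ 0) → `⟨ℋ_{N′}, 𝒬ᵀ_N φ⟩ = ⟨𝒬_{N′} ℋ_{N′}, 𝒬ᵀ_R φ⟩` (§1 + an2's adjointness) → `𝒬_{N′} ℋ_{N′} = δ` (`wH_Q`). -/
theorem vertexPair_eq (hN : N = N' * R) (κ' μ : Fin (d + 1)) (u' Y : Site (d + 1)) :
    ∑ κ'' : Fin (d + 1), ∑' u : Site (d + 1),
        wH (N := N) κ'' κ' (u - (N : ℤ) • u') * lamCoeffOf (KInv (N := N') (d := d)) N' μ Y κ'' u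
      = -contourSumAdj R (fun κ y => wΦ (N := N) κ κ' (y - u')) μ Y := by
  -- the two translated minimiser columns and the translated top Φ-leg
  set A : Form1 (d + 1) ℝ := fun κ'' u => wH (N := N) κ'' κ' (u - (N : ℤ) • u') with hA
  set B : Form1 (d + 1) ℝ := fun α z => wH (N := N') α μ (z - (N' : ℤ) • Y) with hB
  set φ : Form1 (d + 1) ℝ := fun κ y => wΦ (N := N) κ κ' (y - u') with hφ
  -- decay ⇒ bounded and summable
  obtain ⟨δ₁, C₁, hδ₁, h₁⟩ := decay_wH (N := N) (d := d)
  obtain ⟨δ₂, C₂, hδ₂, h₂⟩ := decay_wH (N := N') (d := d)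
  obtain ⟨δ₃, C₃, hδ₃, h₃⟩ := KernelSpecInstance.decay_wΦ (N := N) (d := d)
  have hAb : ∀ κ x, |A κ x| ≤ C₁ := fun κ x => abs_le_of_decay510 hδ₁ (h₁ κ κ') _
  have hAs : ∀ κ, Summable (A κ) := fun κ =>
    summable_shift_sub (summable_of_decay510 hδ₁ (h₁ κ κ')) ((N : ℤ) • u')
  have hBb : ∀ κ x, |B κ x| ≤ C₂ := fun κ x => abs_le_of_decay510 hδ₂ (h₂ κ μ) _
  have hBs : ∀ κ, Summable (B κ) := fun κ =>
    summable_shift_sub (summable_of_decay510 hδ₂ (h₂ κ μ)) ((N' : ℤ) • Y)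
  have hφb : ∀ κ y, |φ κ y| ≤ C₃ := fun κ y => abs_le_of_decay510 hδ₃ (h₃ κ κ') _
  have hcA : ∀ κ l, Summable (curv A κ l) := summable_curv hAs
  have hcB : ∀ κ l, Summable (curv B κ l) := summable_curv hBs
  have hcBb : ∀ κ l x, |curv B κ l x| ≤ 4 * C₂ := fun κ l x => abs_curv_le hBb κ l x
  -- (1) the leg is `−d*d B`
  have hlam : ∀ κ'' u, lamCoeffOf (KInv (N := N') (d := d)) N' μ Y κ'' u = -curvAdj (curv B) κ'' u := by
    intro κ'' u
    rw [lamCoeffOf_KInv_eq_neg_opEL, hB, opEL_shift]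
  -- (2) `d*d A = 𝒬ᵀ_N φ` (Euler–Lagrange WITHOUT gauge term, translated)
  have hEL : curvAdj (curv A) = contourSumAdj N φ := by
    funext α z
    rw [hA, opEL_shift, wH_EL', hφ, contourSumAdj_shift]
  -- (3) summability of the integrand of the left-hand side
  have hS : ∀ κ'', Summable (fun u => A κ'' u * curvAdj (curv B) κ'' u) := fun κ'' =>
    summable_mul_of_bdd' (hAs κ'') (fun u => abs_curvAdj_le hcBb κ'' u)
  -- (4) the chain of pairings
  have hR : NeZero R := ⟨by rintro rfl; exact NeZero.ne N (by rw [hN, mul_zero])⟩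
  have hψb : ∀ κ y, |contourSumAdj R φ κ y| ≤ R * C₃ := fun κ y => abs_contourSumAdj_le φ hφb κ y
  calc ∑ κ'' : Fin (d + 1), ∑' u : Site (d + 1), A κ'' u * lamCoeffOf (KInv (N := N') (d := d)) N' μ Y κ'' u
      = ∑ κ'' : Fin (d + 1), ∑' u : Site (d + 1), -(A κ'' u * curvAdj (curv B) κ'' u) := by
        refine Finset.sum_congr rfl fun κ'' _ => tsum_congr fun u => ?_
        rw [hlam]; ring
    _ = -lip1 A (curvAdj (curv B)) := by
        unfold KKTFluctuationEnergy.lip1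
        rw [Summable.tsum_finsetSum (fun κ'' _ => hS κ''), ← Finset.sum_neg_distrib]
        exact Finset.sum_congr rfl fun κ'' _ => tsum_neg
    _ = -lip1 B (curvAdj (curv A)) := by
        rw [lip1_curvAdj hAb hcB, lip2_comm, ← lip1_curvAdj hBb hcA]
    _ = -∑' y, ∑ κ, contourSumAdj R φ κ y * contourSum N' B κ y := by
        rw [hEL, hN, contourSumAdj_mul, lip1_contourSumAdj hBs hψb]
    _ = -∑' y, ∑ κ, contourSumAdj R φ κ y * (if y - Y = 0 ∧ κ = μ then 1 else 0) := by
        congr 1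
        refine tsum_congr fun y => Finset.sum_congr rfl fun κ _ => ?_
        rw [hB, contourSum_shift, wH_Q]
    _ = -contourSumAdj R φ μ Y := by
        congr 1
        rw [tsum_eq_single Y]
        · rw [Finset.sum_eq_single μ]
          · simp
          · intro κ _ hκ; simp [hκ]
          · intro h; exact absurd (Finset.mem_univ μ) h
        · intro y hy
          refine Finset.sum_eq_zero fun κ _ => ?_
          have : ¬(y - Y = 0 ∧ κ = μ) := fun h => hy (sub_eq_zero.mp h.1)
          simp [this]

/-- [folklore] **SUMMABILITY OF THE PAIRING'S INTEGRAND** (for exchanging the `u`-sum with finite sums downstream): for each `κ″`,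
`u ↦ wH_N κ″ κ′ (u − N•u′) · lamCoeffOf (KInv N′) N′ μ Y κ″ u` is summable (bounded top column × summable `d*d` of the decaying
level-`N′` column; existential decay suffices). -/
theorem summable_wH_mul_lamCoeffOf (κ' μ κ'' : Fin (d + 1)) (u' Y : Site (d + 1)) :
    Summable fun u : Site (d + 1) =>
      wH (N := N) κ'' κ' (u - (N : ℤ) • u') * lamCoeffOf (KInv (N := N') (d := d)) N' μ Y κ'' u := by
  set B : Form1 (d + 1) ℝ := fun α z => wH (N := N') α μ (z - (N' : ℤ) • Y) with hB
  obtain ⟨δ₁, C₁, hδ₁, h₁⟩ := decay_wH (N := N) (d := d)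
  obtain ⟨δ₂, C₂, hδ₂, h₂⟩ := decay_wH (N := N') (d := d)
  have hAs : Summable (fun u : Site (d + 1) => wH (N := N) κ'' κ' (u - (N : ℤ) • u')) :=
    summable_shift_sub (summable_of_decay510 hδ₁ (h₁ κ'' κ')) ((N : ℤ) • u')
  have hBb : ∀ κ x, |B κ x| ≤ C₂ := fun κ x => abs_le_of_decay510 hδ₂ (h₂ κ μ) _
  have hcBb : ∀ κ l x, |curv B κ l x| ≤ 4 * C₂ := fun κ l x => abs_curv_le hBb κ l x
  have hlam : ∀ u, lamCoeffOf (KInv (N := N') (d := d)) N' μ Y κ'' u = -curvAdj (curv B) κ'' u := by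
    intro u
    rw [lamCoeffOf_KInv_eq_neg_opEL, hB, opEL_shift]
  have hS : Summable (fun u => wH (N := N) κ'' κ' (u - (N : ℤ) • u') * curvAdj (curv B) κ'' u) :=
    summable_mul_of_bdd' hAs (fun u => abs_curvAdj_le hcBb κ'' u)
  refine (hS.neg).congr fun u => ?_
  rw [hlam]; ring

/-- [folklore] **TOP LEVEL** (`R = 1`, row S3-Lt): the vertex pairing is minus the top multiplier–multiplier leg itself,
`Σ_{κ″} Σ'_u wH_N κ″ κ′ (u − N•u′) · lamCoeffOf (KInv N) N μ Y κ″ u = −wΦ_N μ κ′ (Y − u′)`. -/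
theorem vertexPair_top (κ' μ : Fin (d + 1)) (u' Y : Site (d + 1)) :
    ∑ κ'' : Fin (d + 1), ∑' u : Site (d + 1),
        wH (N := N) κ'' κ' (u - (N : ℤ) • u') * lamCoeffOf (KInv (N := N) (d := d)) N μ Y κ'' u
      = -wΦ (N := N) μ κ' (Y - u') := by
  rw [vertexPair_eq (N := N) (N' := N) (R := 1) (mul_one N).symm, contourSumAdj_eq]
  simp [ResolventComposition.quo_one]

end Pairing

/-! ## §3 The absolute-value consequence (the only estimate: a triangle inequality over the `R` read-out points) -/

/-- [folklore] The `R` read-out points of `𝒬ᵀ_R` at `Y` lie within sup-distance `1` of `quo R Y`: coordinatewise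
`|quo R (Y − s•e_μ) j − quo R Y j| ≤ 1` for `s < R`. -/
theorem quo_sub_smul_near {D : ℕ} (R : ℕ) [NeZero R] (Y : Site D) (μ : Fin D) {s : ℕ} (hs : s < R) (j : Fin D) :
    |quo R (Y - (s : ℤ) • unitVec μ) j - quo R Y j| ≤ 1 := by
  have hR : (0 : ℤ) < R := by exact_mod_cast Nat.pos_of_ne_zero (NeZero.ne R)
  simp only [quo, Pi.sub_apply, Pi.smul_apply, unitVec_apply, smul_eq_mul]
  by_cases hj : j = μ
  · subst hj
    simp only [if_true, mul_one]
    have hup : (Y j - s) / (R : ℤ) ≤ Y j / (R : ℤ) := Int.ediv_le_ediv hR (by linarith)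
    have hlo : Y j / (R : ℤ) - 1 ≤ (Y j - s) / (R : ℤ) := by
      have h1 : (Y j + (-1) * (R : ℤ)) / (R : ℤ) = Y j / (R : ℤ) + (-1) := Int.add_mul_ediv_right _ _ hR.ne'
      have h2 : (Y j + (-1) * (R : ℤ)) / (R : ℤ) ≤ (Y j - s) / (R : ℤ) := Int.ediv_le_ediv hR (by linarith)
      linarith
    rw [abs_le]; constructor <;> linarith
  · simp [hj]

/-- [folklore] `‖quo R (Y − s•e_μ) − v‖₁ ≥ ‖quo R Y − v‖₁ − 1` for `s < R` (only coordinate `μ` moves, by at most one block). -/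
theorem l1_quo_sub_smul_ge {D : ℕ} (R : ℕ) [NeZero R] (Y v : Site D) (μ : Fin D) {s : ℕ} (hs : s < R) :
    l1 (quo R Y - v) - 1 ≤ l1 (quo R (Y - (s : ℤ) • unitVec μ) - v) := by
  unfold B12Sec2to5.l1
  have hR : (0 : ℤ) < R := by exact_mod_cast Nat.pos_of_ne_zero (NeZero.ne R)
  have hsame : ∀ j, j ≠ μ → quo R (Y - (s : ℤ) • unitVec μ) j = quo R Y j := by
    intro j hj
    simp [quo, hj]
  rw [← Finset.sum_erase_add _ _ (Finset.mem_univ μ), ← Finset.sum_erase_add _ _ (Finset.mem_univ μ)]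
  have he : ∑ j ∈ Finset.univ.erase μ, |(((quo R (Y - (s : ℤ) • unitVec μ) - v) j : ℤ) : ℝ)|
      = ∑ j ∈ Finset.univ.erase μ, |(((quo R Y - v) j : ℤ) : ℝ)| := by
    refine Finset.sum_congr rfl fun j hj => ?_
    rw [Pi.sub_apply, Pi.sub_apply, hsame j (Finset.ne_of_mem_erase hj)]
  rw [he]
  have hμ := quo_sub_smul_near R Y μ hs μ
  have hμ' : |(((quo R Y - v) μ : ℤ) : ℝ)| - 1 ≤ |(((quo R (Y - (s : ℤ) • unitVec μ) - v) μ : ℤ) : ℝ)| := by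
    rw [Pi.sub_apply, Pi.sub_apply]
    push_cast
    have h : |((quo R (Y - (s : ℤ) • unitVec μ) μ : ℤ) : ℝ) - ((quo R Y μ : ℤ) : ℝ)| ≤ 1 := by exact_mod_cast hμ
    have := abs_sub_abs_le_abs_sub (((quo R Y μ : ℤ) : ℝ) - ((v μ : ℤ) : ℝ))
      (((quo R (Y - (s : ℤ) • unitVec μ) μ : ℤ) : ℝ) - ((v μ : ℤ) : ℝ))
    rw [show ((quo R Y μ : ℤ) : ℝ) - ((v μ : ℤ) : ℝ) - (((quo R (Y - (s : ℤ) • unitVec μ) μ : ℤ) : ℝ) - ((v μ : ℤ) : ℝ))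
      = -(((quo R (Y - (s : ℤ) • unitVec μ) μ : ℤ) : ℝ) - ((quo R Y μ : ℤ) : ℝ)) by ring, abs_neg] at this
    linarith
  linarith

/-- [folklore] **`|𝒬ᵀ_R φ| ≤ R·C·e^{δ}·e^{−δ‖quo R Y − v‖₁}`** for a coarse 1-form decaying like `C·e^{−δ‖y − v‖₁}`. -/
theorem abs_contourSumAdj_le_exp {D : ℕ} (R : ℕ) [NeZero R] (φ : Form1 D ℝ) (v : Site D) {C δ : ℝ} (hδ : 0 ≤ δ)
    (hφ : ∀ κ y, |φ κ y| ≤ C * Real.exp (-δ * l1 (y - v))) (μ : Fin D) (Y : Site D) :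
    |contourSumAdj R φ μ Y| ≤ R * (C * Real.exp δ * Real.exp (-δ * l1 (quo R Y - v))) := by
  rw [contourSumAdj_eq]
  refine (Finset.abs_sum_le_sum_abs _ _).trans ?_
  have hC : 0 ≤ C := by
    have h := hφ μ v
    rw [sub_self] at h
    have h0 : l1 (0 : Site D) = 0 := by simp [B12Sec2to5.l1]
    rw [h0, mul_zero, Real.exp_zero, mul_one] at h
    exact (abs_nonneg _).trans h
  calc ∑ s ∈ Finset.range R, |φ μ (quo R (Y - (s : ℤ) • unitVec μ))|
      ≤ ∑ _s ∈ Finset.range R, C * Real.exp δ * Real.exp (-δ * l1 (quo R Y - v)) := by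
        refine Finset.sum_le_sum fun s hs => (hφ μ _).trans ?_
        rw [mul_assoc, ← Real.exp_add]
        refine mul_le_mul_of_nonneg_left (Real.exp_le_exp.mpr ?_) hC
        have h := l1_quo_sub_smul_ge R Y v μ (Finset.mem_range.mp hs)
        nlinarith
    _ = R * (C * Real.exp δ * Real.exp (-δ * l1 (quo R Y - v))) := by simp

section PairingBound

variable {N N' R : ℕ} [NeZero N] [NeZero N']

/-- [folklore] **THE VERTEX PAIRING IN ABSOLUTE VALUE**: with the top multiplier–multiplier leg decaying like `CΦ·e^{−δ‖y‖₁}` from its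
source, the pairing at inner level `N′ = N/R` is `≤ R·CΦ·e^{δ}·e^{−δ‖quo R Y − u′‖₁}` — `R` read-out points of a leg of TOP-level size
(`CΦ ~ N^{−2(d+1)}` in the K-slot currency), localised at the depth-`R` block of `Y` around the vertex block `u′`. -/
theorem abs_vertexPair_le (hN : N = N' * R) (κ' μ : Fin (d + 1)) (u' Y : Site (d + 1)) {CΦ δ : ℝ} (hδ : 0 ≤ δ)
    (hΦ : ∀ κ y, |wΦ (N := N) κ κ' y| ≤ CΦ * Real.exp (-δ * l1 y)) :
    |∑ κ'' : Fin (d + 1), ∑' u : Site (d + 1),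
        wH (N := N) κ'' κ' (u - (N : ℤ) • u') * lamCoeffOf (KInv (N := N') (d := d)) N' μ Y κ'' u|
      ≤ R * (CΦ * Real.exp δ * Real.exp (-δ * l1 (quo R Y - u'))) := by
  have hR : NeZero R := ⟨by rintro rfl; exact NeZero.ne N (by rw [hN, mul_zero])⟩
  rw [vertexPair_eq hN, abs_neg]
  exact abs_contourSumAdj_le_exp R _ u' hδ (fun κ y => hΦ κ (y - u')) μ Y

end PairingBound

end Summit.QuantumFields.BalabanUV.Beta.GAN24.TaylorLamVertexPairing
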